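import Mathlib
import HarnessLib

/-!
# GAP-MODULUS (RULING A28 (3), channel (M), M2 seat): the ground state moves by at most `2√(η/γ)` when the form moves by `η` and has gap `γ`

pub-rhpf cell (M2 seat, generation 4).  HONEST FRAMING: long-odds MECHANISM SEARCH; no RH claims.  PROVED
(kernel-checked, elementary, RH-free; pure real-Hilbert-space algebra, nothing arithmetic):

Let `Q, Q'` be bounded operators on a real inner-product space with `Q` symmetric, `u` a unit eigenvector of `Q` with
eigenvalue `λ` and SPECTRAL GAP `γ > 0` in the form sense (`⟪Q v, v⟫ ≥ (λ + γ)‖v‖²` for `v ⊥ u`), and `u'` a unit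
vector minimising the `Q'`-Rayleigh quotient at least as well as `u` does (`⟪Q' u', u'⟫ ≤ ⟪Q' u, u⟫`), oriented
`⟪u', u⟫ ≥ 0`.  If the two quadratic forms differ by at most `η` on unit vectors, then
  `‖u' − u‖² ≤ 4η/γ`.
Reading (RULING A28 amendment (3), channel (M) = level crossing, owed by m2): with `Q = Q_{a_k}` the (rescaled,
Galerkin) window form at a sampled window `a_k`, `γ_k = ε₂(a_k) − ε₁(a_k)` its certified gap, and
`η_k(δ) ≥ sup_{|a − a_k| ≤ δ} sup_{‖w‖ = 1} |⟪(Q_a − Q_{a_k}) w, w⟫|` a modulus of the form family, every normalised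
ground state `u_a` of `Q_a` (oriented towards `u_{a_k}`) satisfies `‖u_a − u_{a_k}‖ ≤ 2√(η_k(δ)/γ_k)`; so the
hypothesis `hmod` of `forall_pos_of_marginCover` (tree, `Theorems/EvenSectorBartaEvenOneSignedWindowsNoBirthOn.lean`)
holds on `|a − a_k| ≤ δ_k` as soon as `4 η_k(δ_k) / γ_k < m_k²` (after the Galerkin `L² → sup` norm conversion,
which is not part of this file).  `groundState_dist_lt_of_gap` is that sufficient condition.  Square-root loss versus
the Davis–Kahan `sin θ` theorem is accepted for the sake of a two-hypothesis elementary proof.  Instantiate with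
`E := EuclideanSpace ℝ (Fin n)`, `Q := Matrix.toEuclideanCLM A`.  Nothing here implies or assumes RH.
-/

noncomputable section

set_option linter.dupNamespace false  -- the mandated namespace repeats `RiemannHypothesis`

open RealInnerProductSpace

namespace Summit.RiemannHypothesis.RiemannHypothesis.Theorems.PfPersistenceM2Leak

section GapModulus

variable {E : Type*} [NormedAddCommGroup E] [InnerProductSpace ℝ E]

/-- Orthogonal decomposition against a unit vector: `‖u'‖² = ⟪u', u⟫² + ‖u' − ⟪u', u⟫ u‖²`. -/
theorem norm_sq_eq_inner_sq_add_norm_sq_orth (u u' : E) (hu : ‖u‖ = 1) :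
    ‖u'‖ ^ 2 = ⟪u', u⟫ ^ 2 + ‖u' - ⟪u', u⟫ • u‖ ^ 2 := by
  have huu : ⟪u, u⟫ = 1 := by rw [real_inner_self_eq_norm_sq, hu]; norm_num
  have h1 : ‖u' - ⟪u', u⟫ • u‖ ^ 2 = ⟪u' - ⟪u', u⟫ • u, u' - ⟪u', u⟫ • u⟫ :=
    (real_inner_self_eq_norm_sq _).symm
  have h2 : ‖u'‖ ^ 2 = ⟪u', u'⟫ := (real_inner_self_eq_norm_sq _).symm
  rw [h1, h2, inner_sub_left, inner_sub_right, inner_sub_right, real_inner_smul_left, real_inner_smul_left,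
    real_inner_smul_right, real_inner_smul_right, huu, real_inner_comm u u']
  ring

/-- **GAP-MODULUS** (channel (M)): symmetric `Q` with unit eigenvector `u` (`Q u = λ u`) and form gap `γ > 0` on `u^⊥`;
`Q'` within `η` of `Q` as a quadratic form on unit vectors; `u'` a unit vector with `⟪Q' u', u'⟫ ≤ ⟪Q' u, u⟫`
(e.g. a ground state of `Q'`) and `⟪u', u⟫ ≥ 0`.  Then `‖u' − u‖² ≤ 4η/γ`. -/
theorem groundState_dist_sq_le_of_gap (Q Q' : E →L[ℝ] E) (hQ : ∀ v w : E, ⟪Q v, w⟫ = ⟪v, Q w⟫)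
    {u u' : E} (hu : ‖u‖ = 1) (hu' : ‖u'‖ = 1) {lam γ η : ℝ} (heig : Q u = lam • u) (hγ : 0 < γ)
    (hgap : ∀ v : E, ⟪v, u⟫ = 0 → (lam + γ) * ‖v‖ ^ 2 ≤ ⟪Q v, v⟫)
    (hη : ∀ w : E, ‖w‖ = 1 → |⟪Q w, w⟫ - ⟪Q' w, w⟫| ≤ η)
    (hmin : ⟪Q' u', u'⟫ ≤ ⟪Q' u, u⟫) (hor : 0 ≤ ⟪u', u⟫) :
    ‖u' - u‖ ^ 2 ≤ 4 * η / γ := by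
  have huu : ⟪u, u⟫ = 1 := by rw [real_inner_self_eq_norm_sq, hu]; norm_num
  -- the orthogonal part `v := u' - α u`, `α := ⟪u', u⟫`
  set α : ℝ := ⟪u', u⟫ with hα
  set v : E := u' - α • u with hv
  have hvu : ⟪v, u⟫ = 0 := by
    rw [hv, inner_sub_left, real_inner_smul_left, huu, ← hα]; ring
  have huv : ⟪u, v⟫ = 0 := by rw [real_inner_comm]; exact hvu
  have hdec : u' = α • u + v := by rw [hv]; abel
  -- Pythagoras: α² + ‖v‖² = 1
  have hpyth : α ^ 2 + ‖v‖ ^ 2 = 1 := by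
    have := norm_sq_eq_inner_sq_add_norm_sq_orth u u' hu
    rw [hu', ← hα, ← hv] at this
    linarith
  -- the quadratic form splits: ⟪Q u', u'⟫ = α² λ + ⟪Q v, v⟫
  have hQu : ⟪Q u, u⟫ = lam := by rw [heig, real_inner_smul_left, huu, mul_one]
  have hQuv : ⟪Q u, v⟫ = 0 := by rw [heig, real_inner_smul_left, huv, mul_zero]
  have hQvu : ⟪Q v, u⟫ = 0 := by rw [hQ, real_inner_comm]; exact hQuv
  have hsplit : ⟪Q u', u'⟫ = α ^ 2 * lam + ⟪Q v, v⟫ := by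
    rw [hdec, map_add, map_smul]
    simp only [inner_add_left, inner_add_right, real_inner_smul_left, real_inner_smul_right, hQu, hQuv, hQvu]
    ring
  -- lower bound from the gap, upper bound from minimality and the form modulus
  have hα2 : α ^ 2 = 1 - ‖v‖ ^ 2 := by linarith
  have hlow : lam + γ * ‖v‖ ^ 2 ≤ ⟪Q u', u'⟫ := by
    rw [hsplit, hα2]; nlinarith [hgap v hvu]
  have h1 : ⟪Q u', u'⟫ ≤ ⟪Q' u', u'⟫ + η := by
    have := (abs_le.mp (hη u' hu')).2; linarith
  have h2 : ⟪Q' u, u⟫ ≤ ⟪Q u, u⟫ + η := by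
    have := (abs_le.mp (hη u hu)).1; linarith
  have hup : ⟪Q u', u'⟫ ≤ lam + 2 * η := by linarith [hQu]
  have hv2 : γ * ‖v‖ ^ 2 ≤ 2 * η := by linarith
  -- ‖u' - u‖² = (α - 1)² + ‖v‖² ≤ 2 ‖v‖²
  have hdist : ‖u' - u‖ ^ 2 = (α - 1) ^ 2 + ‖v‖ ^ 2 := by
    have hrew : u' - u = (α - 1) • u + v := by rw [hdec, sub_smul, one_smul]; abel
    rw [hrew, ← real_inner_self_eq_norm_sq ((α - 1) • u + v)]
    simp only [inner_add_left, inner_add_right, real_inner_smul_left, real_inner_smul_right, huu, huv, hvu]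
    rw [real_inner_self_eq_norm_sq]
    ring
  have hα1 : α ≤ 1 := by nlinarith [hpyth, sq_nonneg ‖v‖]
  have hαsq : (α - 1) ^ 2 ≤ ‖v‖ ^ 2 := by nlinarith [hpyth, hor, hα1]
  rw [le_div_iff₀ hγ, hdist]
  nlinarith [hv2, hαsq]

/-- **GAP-MODULUS, margin form** (the `hmod` hypothesis of `forall_pos_of_marginCover`, before the Galerkin
`L² → sup` conversion): under the hypotheses of `groundState_dist_sq_le_of_gap`, if `4η/γ < m²` with `0 < m` then
`‖u' − u‖ < m`. -/
theorem groundState_dist_lt_of_gap (Q Q' : E →L[ℝ] E) (hQ : ∀ v w : E, ⟪Q v, w⟫ = ⟪v, Q w⟫)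
    {u u' : E} (hu : ‖u‖ = 1) (hu' : ‖u'‖ = 1) {lam γ η m : ℝ} (heig : Q u = lam • u) (hγ : 0 < γ)
    (hgap : ∀ v : E, ⟪v, u⟫ = 0 → (lam + γ) * ‖v‖ ^ 2 ≤ ⟪Q v, v⟫)
    (hη : ∀ w : E, ‖w‖ = 1 → |⟪Q w, w⟫ - ⟪Q' w, w⟫| ≤ η)
    (hmin : ⟪Q' u', u'⟫ ≤ ⟪Q' u, u⟫) (hor : 0 ≤ ⟪u', u⟫) (hm : 0 < m) (hbudget : 4 * η / γ < m ^ 2) :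
    ‖u' - u‖ < m := by
  have h := groundState_dist_sq_le_of_gap Q Q' hQ hu hu' heig hγ hgap hη hmin hor
  have hsq : ‖u' - u‖ ^ 2 < m ^ 2 := lt_of_le_of_lt h hbudget
  by_contra hcon
  have hcon : m ≤ ‖u' - u‖ := not_lt.mp hcon
  have : m ^ 2 ≤ ‖u' - u‖ ^ 2 := by
    have h0 : 0 ≤ m := hm.le
    nlinarith [mul_le_mul hcon hcon h0 (norm_nonneg _)]
  linarith

/-- **Form modulus from an operator-norm modulus**: `|⟪Q w, w⟫ − ⟪Q' w, w⟫| ≤ ‖Q − Q'‖` on unit vectors — the usual way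
to supply `hη` (a Lipschitz bound `‖Q_a − Q_{a_k}‖ ≤ L_k |a − a_k|` of the window-form family then gives
`η_k(δ) = L_k δ`). -/
theorem abs_inner_sub_le_opNorm (Q Q' : E →L[ℝ] E) (w : E) (hw : ‖w‖ = 1) :
    |⟪Q w, w⟫ - ⟪Q' w, w⟫| ≤ ‖Q - Q'‖ := by
  have hrew : ⟪Q w, w⟫ - ⟪Q' w, w⟫ = ⟪(Q - Q') w, w⟫ := by
    rw [← inner_sub_left]; rfl
  rw [hrew]
  calc |⟪(Q - Q') w, w⟫| ≤ ‖(Q - Q') w‖ * ‖w‖ := abs_real_inner_le_norm _ _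
    _ ≤ ‖Q - Q'‖ * ‖w‖ * ‖w‖ := mul_le_mul_of_nonneg_right ((Q - Q').le_opNorm w) (norm_nonneg _)
    _ = ‖Q - Q'‖ := by rw [hw]; ring

end GapModulus

end Summit.RiemannHypothesis.RiemannHypothesis.Theorems.PfPersistenceM2Leak

end
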